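import Summits.AtomisticToContinuum.Crystallization.Theorems.ChartedZeroExcessLayeredLatticeLiouvilleZZZVB

/-!
# ChartedZeroExcess · LayeredLatticeLiouville ZZZV (lens-2 g89 NODE 89 «LabelChain», part 3 of 3: ZZZV-5 the node `labelChain_exit` = (UXᴸ) unfolded,
# ZZZV-6 `offTubeBulkExitP_of_labelChain`, `offTubeBulkExitP_fat`, `offTubeBondExitP_fat'`, `offTubeRigidGapP_fat'`, the door W2⁵′ `mildCoolMoatCorePG_W2'''''`)

See part 1 (`…ZZZVA`) for the node's module docstring (thesis, lens, mechanism, constants, critic remarks).  0 sorry; imports = part 2 only; axioms standard.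
-/

noncomputable section
open scoped BigOperators Classical InnerProductSpace RealInnerProductSpace
open MeasureTheory Set Metric Filter Topology
open Literature.Geometry.DiscreteGeometry (IsTwoShellGoodSet fccTwoShellPattern hcpTwoShellPattern card_filter_norm_eq_one_of_twoShellPattern
  norm_of_mem_twoShellPattern)
open Literature.MathematicalPhysics.StatisticalMechanics (lennardJones)

namespace Summit.AtomisticToContinuum.Crystallization.Theorems.ChartedZeroExcessLayeredLatticeLiouville

open Summit.AtomisticToContinuum.Crystallization.Theorems.ChartedPlanarOrderRigidityDoor (E3 IsClean)
open Summit.AtomisticToContinuum.Crystallization.Theorems.ChartedPlanarOrderDensityDichotomy (μS IsSep)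
open Summit.AtomisticToContinuum.Crystallization.Theorems.ChartedPlanarOrderCleanScaleP (IsCleanP IsDoorSetP)
open Summit.AtomisticToContinuum.Crystallization.Theorems.ChartedPlanarOrderMesoCut (LayeredHom EnvClose)
open Summit.AtomisticToContinuum.Crystallization.Theorems.ChartedPlanarOrderDoorLayeredOsc (IsTwoShellAffineGood mem_iff_μS_singleton_ne_zero)

/-! ### ZZZV-5  The node: (UXᴸ) proved -/

section Node

open Summit.AtomisticToContinuum.Crystallization.Theorems.ChartedPlanarOrderCleanStackedIndependent (setOf_μS_ne_zero)

/-- ★★★ **NODE 89 (UXᴸ) PROVED — THE LABEL CHAIN.**  The unfolded statement of `OffTubeBulkExitP` at the record shadow dials `(σ, ϑr, Rs) =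
(17/20, 10⁻⁴, 5)` and ceiling `aHi = 1`, for symbolic `(rΘ, q, ρ, ℓ, ε, Rg, sb, dB)` in the LABEL-CHAIN REGIME `q ≤ rΘ`, `q² ≤ 2rΘ`, `q + rΘ ≤ 14`,
`rΘ + 5 ≤ ρ < ℓ`, `Rg ≥ 23/5`, `0 ≤ sb`, `7·sb ≤ 7/20`, `ε + 7·sb ≤ dB`: a `dB`-far core site forces a bond-scale HOP among core sites.
PROOF (contrapositive).  No hop ⇒ deviations `e = p − lab p` of core sites with labels within `Rg` agree to `sb` (★).  The far site `p₀` is hot, so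
some `k₁ ∈ K` is within `rΘ`; with `u` the unit vector of `p₀ − x₀` and `kᵤ ∈ K` maximising `⟪·, u⟫`, the exit point `z = kᵤ + (rΘ + 6/5)•u` is within
`q + rΘ + 6/5 ≤ 63/4` of `p₀` and the whole segment `[p₀, z]` within `R₀ = rΘ + 6/5` of `kᵤ`.  Walk the LABELS greedily through the shadow crystal
(`shadow_descent_step`, lifted to atoms by `exists_contact_of_bonded_label`) along `21` way-points in `7` blocks of `3` (`labelChain_blocks`): the
end atom has deviation within `7·sb` of `e₀` and sits within `4/5 + 7·sb` of `z`, in the cap `{⟪· − kᵤ, u⟫ ≥ rΘ + 1/20}` beyond every core site's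
`rΘ`-ball (`labelChain_cap_far`), hence is COOL and registered: `‖e_end‖ ≤ ε`, so `‖e₀‖ ≤ ε + 7·sb ≤ dB` — contradicting `dB < ‖e₀‖`. [this file, g89] -/
theorem labelChain_exit {ϑc ϑp r rΘ q rsh ρ rm ε rI ℓ Rg sb dB Λ θ s : ℝ}
    (hq : q ≤ rΘ) (hq2 : q ^ 2 ≤ 2 * rΘ) (hqr : q + rΘ ≤ 14) (hρ : rΘ + 5 ≤ ρ) (hρℓ : ρ < ℓ) (hRg : 23 / 5 ≤ Rg) (hsb : 0 ≤ sb)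
    (hsb7 : 7 * sb ≤ 7 / 20) (hdB : ε + 7 * sb ≤ dB) :
    ∀ δ : ℝ, 0 < δ → ∀ a : ℝ, 0 < a →
      ∀ S : Set E3, IsDoorSetP 1 δ S → (∀ z : E3, Summable fun y : S => lennardJones (dist z (y : E3))) →
        (∀ p ∈ S, IsTwoShellAffineGood θ S p) →
          ∀ (L : E3 ≃L[ℝ] E3) (w : ℤ → E3), IsEquilChart a s Λ L w →
            ∀ (x₀ : E3) (K : Set E3), K ⊆ S → (∀ k ∈ K, dist k x₀ ≤ q) →
              IsTameOn ϑp S (LayeredHom (L : E3 →L[ℝ] E3) w) (coreOf S K rm) →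
                IsTameOn ϑc S (LayeredHom (L : E3 →L[ℝ] E3) w) (moatIn S K r (r + rsh)) →
                  ∀ (n : ℕ) (xf : Fin n → E3), Function.Injective xf → Set.range xf = coreOf S K ρ →
                    ∀ (L' : E3 →L[ℝ] E3) (w' : ℤ → E3) (U : E3 ≃ₗᵢ[ℝ] E3) (t : E3),
                      IsCoolShadowCrystal (17 / 20) (1 / 10000) 5 ε r rI ℓ S K (LayeredHom (L : E3 →L[ℝ] E3) w) L' w' U t →
                        ∀ lab : E3 → E3, IsBondLabel ε rΘ ℓ S K (placedCrystal L' w' U t) lab →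
                          ∀ i : Fin n, dB < dist (xf i) (lab (xf i)) →
                            ∃ i' j' : Fin n, i' ≠ j' ∧ dist (lab (xf i')) (lab (xf j')) ≤ Rg ∧
                              sb < dist (xf i' - xf j') (lab (xf i') - lab (xf j')) := by
  intro δ hδ a ha S hS hsum hgood L w hLw x₀ K hKS hKq hmild hcool n xf hxf hrange L' w' U t hSC lab hlab i hfar
  by_contra hno
  push Not at hno
  set H : Set E3 := LayeredHom (L : E3 →L[ℝ] E3) w with hHdef
  set C : Set E3 := placedCrystal L' w' U t with hCdef
  set p₀ : E3 := xf i with hp₀def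
  set e₀ : E3 := p₀ - lab p₀ with he₀def
  -- constants
  set R₀ : ℝ := rΘ + 6 / 5 with hR₀def
  set R₁ : ℝ := R₀ + 19 / 10 with hR₁def
  -- (★) the no-hop hypothesis on core sites
  have hstar : ∀ p ∈ coreOf S K ρ, ∀ p' ∈ coreOf S K ρ, dist (lab p) (lab p') ≤ Rg → ‖(p - lab p) - (p' - lab p')‖ ≤ sb := by
    intro p hp p' hp' hd
    rw [← hrange] at hp hp'
    obtain ⟨i', rfl⟩ := hp
    obtain ⟨j', rfl⟩ := hp'
    by_cases hij : i' = j'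
    · subst hij; rw [sub_self, norm_zero]; exact hsb
    · have h := hno i' j' hij hd
      rw [dist_eq_norm] at h
      have e : xf i' - xf j' - (lab (xf i') - lab (xf j')) = (xf i' - lab (xf i')) - (xf j' - lab (xf j')) := by abel
      rwa [e] at h
  -- the chart crystal is clean, so the shadow crystal supplies descent steps and has ≤ 12 bonded sites per site
  have hH : ∀ x ∈ H, IsTwoShellGoodSet (1 / 16) (9 / 10) 1 H x := by
    intro x hx
    have hcl := hLw.2.2.2.1
    have h := hcl x ((mem_iff_μS_singleton_ne_zero H x).2 hx)
    rwa [setOf_μS_ne_zero] at h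
  have hstep : ∀ c ∈ C, ∀ g : E3, ∃ a : ℝ, 9 / 10 ≤ a ∧ a ≤ 1 ∧ ∃ c' ∈ C, ∃ y : E3,
      dist c' y ≤ a / 16 + 1 / 10000 ∧ dist y c = a ∧ dist y (c + g) ^ 2 ≤ ‖g‖ ^ 2 - Real.sqrt 2 * a * ‖g‖ + a ^ 2 :=
    fun c hc g => shadow_descent_step hSC hH (by norm_num) hc g
  have hB : ∀ c ∈ C, ({c' | c' ∈ C ∧ IsBond c c'}).ncard ≤ 12 ∧ ({c' | c' ∈ C ∧ IsBond c c'}).Finite :=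
    fun c hc => bonded_placed_le_twelve hSC hH (by norm_num) (by norm_num) (by norm_num) hc
  -- the far site is a hot core atom
  have hp₀core : p₀ ∈ coreOf S K ρ := by rw [← hrange]; exact Set.mem_range_self i
  have hp₀S : p₀ ∈ S := hp₀core.1
  have hρ0 : 0 ≤ ρ := by obtain ⟨-, k, -, hk⟩ := hp₀core; exact dist_nonneg.trans hk
  have hreg := hlab.2.2.2
  obtain ⟨k₁, hk₁K, hk₁⟩ : ∃ k₁ ∈ K, dist p₀ k₁ ≤ rΘ := by
    by_contra h
    push Not at h
    have hz : ∃ k ∈ K, dist p₀ k < ℓ := by obtain ⟨-, k, hk, hkd⟩ := hp₀core; exact ⟨k, hk, by linarith⟩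
    have := hreg p₀ hp₀S hz h
    linarith
  -- the exit direction
  obtain ⟨u₁, hu₁⟩ := exists_norm_eq E3 zero_le_one
  set D : ℝ := ‖p₀ - x₀‖ with hDdef
  have hD0 : 0 ≤ D := norm_nonneg _
  obtain ⟨u, hu, hDu⟩ : ∃ u : E3, ‖u‖ = 1 ∧ p₀ - x₀ = D • u := by
    by_cases h0 : p₀ - x₀ = 0
    · refine ⟨u₁, hu₁, ?_⟩; rw [hDdef, h0, norm_zero, zero_smul]
    · refine ⟨D⁻¹ • (p₀ - x₀), ?_, ?_⟩
      · rw [norm_smul, norm_inv, norm_norm, inv_mul_cancel₀ (norm_ne_zero_iff.2 h0)]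
      · rw [smul_smul, mul_inv_cancel₀ (norm_ne_zero_iff.2 h0), one_smul]
  -- the far core site `kᵤ` in direction `u`
  have hKcore : K ⊆ coreOf S K ρ := fun k hk => ⟨hKS hk, k, hk, by rw [dist_self]; exact hρ0⟩
  have hKfin : K.Finite := by rw [← hrange] at hKcore; exact (Set.finite_range xf).subset hKcore
  obtain ⟨kᵤ, hkᵤK, hkmax⟩ := Set.exists_max_image K (fun k => ⟪k, u⟫) hKfin ⟨k₁, hk₁K⟩
  have hkᵤS : kᵤ ∈ S := hKS hkᵤK
  -- geometry of the start, the exit vector and the segment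
  have hstart : dist p₀ kᵤ ≤ R₀ := by
    have h1 := labelChain_start_sq hu hDu hD0 hk₁ (hkmax k₁ hk₁K) (hKq kᵤ hkᵤK)
    have hrΘ : 0 ≤ rΘ := dist_nonneg.trans hk₁
    have h2 : dist p₀ kᵤ ^ 2 ≤ R₀ ^ 2 := by rw [hR₀def]; nlinarith
    have h' := Real.sqrt_le_sqrt h2
    rwa [Real.sqrt_sq dist_nonneg, Real.sqrt_sq (by linarith)] at h'
  set z : E3 := kᵤ + R₀ • u with hzdef
  set V : E3 := z - p₀ with hVdef
  have hDle : D ≤ 2 * R₀ := by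
    have h1 : D ≤ dist p₀ k₁ + dist k₁ x₀ := by rw [hDdef, ← dist_eq_norm]; exact dist_triangle _ _ _
    have h2 := hKq k₁ hk₁K
    rw [hR₀def]; linarith
  have hV : ‖V‖ ≤ 63 / 4 := by
    have h := labelChain_exit_norm (lam := R₀) hu hDu hD0 hDle (hKq kᵤ hkᵤK)
    rw [hVdef, hzdef, hR₀def] at *; linarith
  have hzk : dist z kᵤ ≤ R₀ := by
    rw [hzdef, dist_eq_norm, add_sub_cancel_left, norm_smul, hu, mul_one, Real.norm_eq_abs, abs_of_nonneg (by rw [hR₀def]; linarith [dist_nonneg.trans hk₁])]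
  -- way-points
  set tw : ℕ → E3 := fun j => lab p₀ + ((j : ℝ) / 21) • V with htwdef
  have htw : ∀ j, tw j = lab p₀ + ((j : ℝ) / 21) • V := fun j => rfl
  have hballj : ∀ j : ℕ, j ≤ 21 → dist (tw j + e₀) kᵤ ≤ R₀ := by
    intro j hj
    have e : tw j + e₀ = p₀ + ((j : ℝ) / 21) • (z - p₀) := by rw [htw, he₀def, hVdef]; abel
    rw [e]
    have hj' : (j : ℝ) ≤ 21 := by exact_mod_cast hj
    exact labelChain_segment_ball hstart hzk (by positivity) (by rw [div_le_one (by norm_num : (0:ℝ) < 21)]; exact hj')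
  -- the chain context
  have hR₁ℓ : R₁ + 17 / 16 < ℓ := by rw [hR₁def, hR₀def]; linarith
  have hlabC : ∀ p ∈ S, dist p kᵤ ≤ R₁ → lab p ∈ C := fun p hp hpk => hlab.1 p hp ⟨kᵤ, hkᵤK, by linarith⟩
  have hlift : ∀ p ∈ S, dist p kᵤ ≤ R₁ → ∀ c' ∈ C, IsBond (lab p) c' → ∃ p' ∈ S, dist p p' ≤ 17 / 16 ∧ lab p' = c' := by
    intro p hp hpk c' hc' hb
    obtain ⟨p', hp'S, -, hd, hl⟩ := exists_contact_of_bonded_label hS hlab hB hp ⟨kᵤ, hkᵤK, by linarith⟩ hc' hb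
    exact ⟨p', hp'S, hd, hl⟩
  have hcoreR : ∀ p ∈ S, dist p kᵤ ≤ R₁ + 17 / 16 → p ∈ coreOf S K ρ := fun p hp hpk =>
    ⟨hp, kᵤ, hkᵤK, by rw [hR₁def, hR₀def] at hpk; linarith⟩
  have hR₁ : R₀ + 19 / 10 ≤ R₁ := le_of_eq hR₁def.symm
  have hp₀k : dist p₀ kᵤ ≤ R₁ := by linarith
  -- run the chain: seven blocks
  obtain ⟨pe, hpeS, hpek, hpet, hpee⟩ := labelChain_blocks (core := coreOf S K ρ) tw htw hV hstep le_rfl hlabC hlift hcoreR hstar hRg hsb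
    hsb7 hR₁ he₀def hp₀S hp₀k hballj 7 le_rfl
  -- the end atom is near the exit point, hence cool and registered
  have htw21 : tw 21 + e₀ = z := by
    rw [htw, he₀def, hVdef, show ((21 : ℕ) : ℝ) / 21 = 1 by norm_num, one_smul]; abel
  have hpez : dist pe z ≤ 4 / 5 + 7 * sb := by
    have e : pe - z = (lab pe - tw (3 * 7)) + ((pe - lab pe) - e₀) := by rw [← htw21, show 3 * 7 = 21 by rfl]; abel
    rw [dist_eq_norm, e]
    have := norm_add_le (lab pe - tw (3 * 7)) ((pe - lab pe) - e₀)
    rw [← dist_eq_norm] at this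
    push_cast at hpee
    linarith
  have hcoolpe : ∀ k ∈ K, rΘ < dist pe k := by
    intro k hk
    have h := labelChain_cap_far hu (hkmax k hk) hzdef hpez
    rw [hR₀def] at h; linarith
  have hpez' : ∃ k ∈ K, dist pe k < ℓ := ⟨kᵤ, hkᵤK, by linarith⟩
  have hpe_reg : dist pe (lab pe) ≤ ε := hreg pe hpeS hpez' hcoolpe
  -- conclusion: `‖e₀‖ ≤ ε + 7 sb ≤ dB`
  have he₀ : ‖e₀‖ ≤ ε + 7 * sb := by
    have e : e₀ = (pe - lab pe) - ((pe - lab pe) - e₀) := by abel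
    have h1 := norm_sub_le (pe - lab pe) ((pe - lab pe) - e₀)
    have h2 : ‖pe - lab pe‖ ≤ ε := by rw [← dist_eq_norm]; exact hpe_reg
    rw [e]
    push_cast at hpee
    linarith
  rw [he₀def, ← dist_eq_norm] at he₀
  linarith

end Node

/-! ### ZZZV-6  (UXᴸ) in the label-chain regime, its fat instance, and the door W2⁵′ -/

section Doors

/-- ★★★ **(UXᴸ) PROVED IN THE LABEL-CHAIN REGIME**: `OffTubeBulkExitP` at the record shadow dials `(σ, ϑr, Rs) = (17/20, 10⁻⁴, 5)`, ceiling `aHi = 1`,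
for all `(rΘ, q, ρ, ℓ, ε, Rg, sb, dB)` with `q ≤ rΘ`, `q² ≤ 2rΘ`, `q + rΘ ≤ 14`, `rΘ + 5 ≤ ρ < ℓ`, `23/5 ≤ Rg`, `0 ≤ sb`, `7·sb ≤ 7/20`, `ε + 7·sb ≤ dB`
(and arbitrary `ϑc ϑp r rsh rm rI Λ θ s`). [this file, g89] -/
theorem offTubeBulkExitP_of_labelChain {ϑc ϑp r rΘ q rsh ρ rm ε rI ℓ Rg sb dB Λ θ s : ℝ}
    (hq : q ≤ rΘ) (hq2 : q ^ 2 ≤ 2 * rΘ) (hqr : q + rΘ ≤ 14) (hρ : rΘ + 5 ≤ ρ) (hρℓ : ρ < ℓ) (hRg : 23 / 5 ≤ Rg) (hsb : 0 ≤ sb)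
    (hsb7 : 7 * sb ≤ 7 / 20) (hdB : ε + 7 * sb ≤ dB) :
    OffTubeBulkExitP ϑc ϑp r rΘ q rsh ρ rm (17 / 20) (1 / 10000) 5 ε rI ℓ Rg sb dB 1 Λ θ s :=
  labelChain_exit hq hq2 hqr hρ hρℓ hRg hsb hsb7 hdB

/-- ★★★ **(UXᴸ)_fat PROVED** — the verbatim hypothesis `hUX` of the tree door `mildCoolMoatCorePG_W2⁗` (g88 ZZZU): `rΘ = 145/16`, `q = 4`, `ρ = 16`,
`ℓ = 43/2`, `ε = 10⁻⁴`, `Rg = 121/25`, `sb = 249/5000`, `dB = 21/50` (`4 ≤ 145/16`, `16 ≤ 145/8`, `14.0625 ≤ 16 < 21.5`, `4.6 ≤ 4.84`,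
`0.3486 ≤ 0.35`, `0.3487 ≤ 0.42`). [this file, g89] -/
theorem offTubeBulkExitP_fat {ϑc : ℝ} :
    OffTubeBulkExitP ϑc (1 / 10) 8 (145 / 16) 4 12 16 16 (17 / 20) (1 / 10000) 5 (1 / 10000) 10 (43 / 2) (121 / 25) (249 / 5000) (21 / 50) 1 2
      (1 / 16) (1 / 50) :=
  offTubeBulkExitP_of_labelChain (by norm_num) (by norm_num) (by norm_num) (by norm_num) (by norm_num) (by norm_num) (by norm_num) (by norm_num)
    (by norm_num)

/-- ★★★ **(BXᴸ)_fat PROVED** (the bond exit off the tube, now unconditional): `offTubeBondExitP_fat` of g88 with its hypothesis discharged. [this file, g89] -/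
theorem offTubeBondExitP_fat' {ϑc : ℝ} :
    OffTubeBondExitP ϑc (1 / 10) 8 (145 / 16) 4 12 16 16 (17 / 20) (1 / 10000) 5 (1 / 10000) 10 (43 / 2)
      (121 / 25) (249 / 5000) (249 / 5000) (21 / 50) 1 2 (1 / 16) (1 / 50) :=
  offTubeBondExitP_fat offTubeBulkExitP_fat

/-- ★★★ **(TGᴸ)(m₀ = 10⁻⁴)_fat PROVED** (the off-tube rigid gap leaf of W2‴, now unconditional, for every `4·sb₁, 4·dI₁ ≤ 249/5000`). [this file, g89] -/
theorem offTubeRigidGapP_fat' {ϑc sb₁ dI₁ dB₁ : ℝ} (hsb : 4 * sb₁ ≤ 249 / 5000) (hdI : 4 * dI₁ ≤ 249 / 5000) :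
    OffTubeRigidGapP ϑc (1 / 10) 8 (145 / 16) 4 12 16 16 (17 / 20) (1 / 10000) 5 (1 / 10000) 10 (43 / 2)
      (121 / 25) (249 / 5000) (249 / 5000) (21 / 50) sb₁ dI₁ dB₁ (1 / 10000) 1 2 (1 / 16) (1 / 50) :=
  offTubeRigidGapP_fat hsb hdI offTubeBondExitP_fat'

/-- ★★★ **THE FAT RECORD DOOR W2⁵′ (PROVED)**: `[MCMC](ϑc) ⟸ (SC) ∧ (X1ᴸ)(lam > 0) ∧ (X2ᴸ) ∧ (RGᴸ)(cR) ∧ (DWᴹ)(cE, σ₀)` with `σ₀ < cE·cR·10⁻⁴` — the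
W2⁗ fat door (tree ZZZU) with its leaf (UXᴸ)_fat DISCHARGED by the label chain.  Residual leaves of the energetic route of record after NODE 89: the
LJ-free (X1ᴸ), (X2ᴸ), (RGᴸ) and the monotone (DWᴹ). [this file, g89] -/
theorem mildCoolMoatCorePG_W2''''' {ϑc sb₁ dI₁ dB₁ lam cR cE σ₀ : ℝ} (hlam : 0 < lam) (hcR : 0 ≤ cR) (hcE : 0 ≤ cE)
    (hgap : σ₀ < cE * (cR * (1 / 10000))) (hsb : 4 * sb₁ ≤ 249 / 5000) (hdI : 4 * dI₁ ≤ 249 / 5000) (hdB : dB₁ ≤ 2 / 5) (hsb₀ : 0 ≤ sb₁)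
    (hdI₀ : 0 ≤ dI₁) (hdB₀ : 0 ≤ dB₁)
    (hSC : CoolZoneShadowCrystalP ϑc (1 / 10) 8 4 12 16 (17 / 20) (1 / 10000) 5 (1 / 10000) 10 (43 / 2) 1 2 (1 / 16) (1 / 50))
    (hX1 : LabelTubeConvexityP ϑc tameRadius (1 / 10) 8 (145 / 16) 4 12 16 16 (17 / 20) (1 / 10000) 5 (1 / 10000) 10 (43 / 2) (1 / 5000) (121 / 25)
      (249 / 5000) (249 / 5000) (21 / 50) lam 1 2 (1 / 16) (1 / 50))
    (hX2 : LabelLoadedTubeAprioriP ϑc tameRadius (1 / 10) 8 (145 / 16) 4 12 16 16 (17 / 20) (1 / 10000) 5 (1 / 10000) 10 (43 / 2) (1 / 5000)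
      (121 / 25) (249 / 5000) (249 / 5000) (21 / 50) sb₁ dI₁ dB₁ 1 2 (1 / 16) (1 / 50))
    (hRG : DeficitRigidityP ϑc (1 / 10) 8 (145 / 16) 4 12 16 16 (17 / 20) (1 / 10000) 5 (1 / 10000) 10 (43 / 2) (121 / 25) sb₁ dI₁ dB₁ (121 / 25)
      cR 1 2 (1 / 16) (1 / 50))
    (hDW : DeficitWellMinP ϑc tameRadius (1 / 10) 8 (145 / 16) 4 12 16 16 (17 / 20) (1 / 10000) 5 (1 / 10000) 10 (43 / 2) (121 / 25) sb₁ dI₁ dB₁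
      (121 / 25) cE σ₀ 1 2 (1 / 16) (1 / 50)) :
    MildCoolMoatCorePG ϑc tameRadius (1 / 10) 8 4 12 16 1 2 (1 / 16) (1 / 50) :=
  mildCoolMoatCorePG_W2'''' hlam hcR hcE hgap hsb hdI hdB hsb₀ hdI₀ hdB₀ hSC hX1 hX2 hRG offTubeBulkExitP_fat hDW

end Doors


end Summit.AtomisticToContinuum.Crystallization.Theorems.ChartedZeroExcessLayeredLatticeLiouville

end
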